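import Mathlib
import Literature.NumberTheory.Irrationality.LaiSprangZudilin2026.LeadingCoefficient
import HarnessLib

/-!
# Lai–Sprang–Zudilin 2026, §§4–5: the two solutions `ρ_n`, `ρ_{n,0}` of the recursion (eq:rec), the
determinant formula (Lemma 4.2 (b), PROVED) and the arithmetic lemmas 5.1, 5.3 (typed), 5.4 (PROVED from them)

Topic `Literature/NumberTheory/Irrationality/LaiSprangZudilin2026`.  Source: L. Lai, J. Sprang, W. Zudilin,
*A note on the irrationality of `ζ₂(5)`*, IMRN **2026**:16, rnag180 = arXiv:2505.05005 [LaiSprangZudilin2026]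
(held text `paper:arxiv-2505.05005`, arXiv numbering; §4 = p. 7, §5 = pp. 8–9 of the text, read on the page).
Companion of `LeadingCoefficient.lean` (the typed fact `recurrence` = Lemma 5.2 for the printed double sum
`lszRho` of `Literature.Combinatorics.Enumerative.TwoAdicZetaFiveAperyLikeLucas`).  Consumer: the cell
`zeta5-irr` line L-DC (zi-p2 `probes/DC/DenCon.lean`: `ZiP2.DC.sol/rho/rho0` have the same bodies as
`recSol/rhoQ/rho0` below, so the bridge is `rfl`).

## Source, as printed

* §3–4: `R_n(t) = 2^{8n}(2t+n)(t+½)_n⁴/(t)_{n+1}⁴ = Σ_{i=1}^{4} Σ_{k=0}^{n} r_{n,i,k}/(t+k)^i`;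
  `S_n = ρ_{n,0} + ρ_{n,3}ζ₂(5)` (Lemma 3.3) with `ρ_{n,0}`, `ρ_{n,3}` the explicit partial-fraction sums
  (def_rho_0), (def_rho_3).  **Lemma 4.2.** «(a) For each `i ∈ {0,3}`, the sequence `(ρ_{n,i})_{n≥0}` satisfies
  the three-term relation (eq:rec) [`(n+1)⁵y_{n+1} − 32(2n+1)(8n⁴+16n³+20n²+12n+3)y_n + 2¹⁶n⁵y_{n−1} = 0`].
  (b) For any `n ∈ ℤ_{≥0}`, we have the 'determinant' formula
  `ρ_{n,0}ρ_{n+1,3} − ρ_{n+1,0}ρ_{n,3} = 3·2^{16n+18}/(n+1)⁵ ≠ 0`.»  Proof of (b): «since `ρ_{0,0} = 0`,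
  `ρ_{0,3} = 768`, `ρ_{1,0} = −1024`, `ρ_{1,3} = 73728` … For `n ≥ 1` it follows inductively by using the
  recursions from part (a)».  **Lemma 5.2**: `ρ_{n,3} = 768ρ_n`, `ρ_n` the double sum (`lszRho`), `ρ_0 = 1`,
  `ρ_1 = 96`.
* §5 (`d_n = lcm(1,…,n)`): **Lemma 5.1.** «For `n ∈ ℤ_{>0}`, `d_n·ρ_{n,3} ∈ ℤ` and `d_n⁶·ρ_{n,0} ∈ ℤ`.»
  **Lemma 5.3.** «For any prime `p > max{√(2n), 3}`, we have `v_p(ρ_{n,0}) ≥ −5`.»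
  **Lemma 5.4.** «For any `n ∈ ℤ_{>0}`, we have `Π_n^{−1} d_n⁶·ρ_{n,0} ∈ ℤ`, where `Π_n` denotes the following
  product over primes: `Π_n = ∏_{max{√(2n),3} < p ≤ n} p`.  Proof. This follows from Lemmas 5.1 and 5.3.»
  The expectation (5.2) «den-con» `d_n⁵ρ_{n,0} ∈ ℤ` is OPEN in print («based on a numerical check for
  `n ≤ 5000`») and is NOT typed here (a conjecture is not Literature).

## How it is typed

By Lemma 4.2 (a) and the printed initial values, `ρ_{n,0}` and `ρ_{n,3} = 768ρ_n` ARE the solutions of (eq:rec)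
with initial data `(0, −1024)` and `768·(1, 96)`; the partial-fraction sums (def_rho_0)/(def_rho_3) and `R_n(t)`
are not formalised.  Accordingly:
* `recSol y₀ y₁` — the solution of (eq:rec) with `y_0 = y₀`, `y_1 = y₁` (leading coefficient `(n+1)⁵ ≠ 0`);
  `rhoQ = recSol 1 96` (`ρ_n` as a rational number), `rho0 = recSol 0 (−1024)` (`ρ_{n,0}`), `rho3 n = 768·rhoQ n`
  (`ρ_{n,3}`); `recSol_rec` (the recursion), kernel values `rhoQ_two`, `rho0_two`, `rho0_three`.
* PROVED: `rhoQ_eq_lszRho` — under the typed fact `recurrence` (Lemma 5.2), `rhoQ n = lszRho n` for all `n`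
  (uniqueness of solutions); `wronskian_succ` and **`determinant_formula`** = Lemma 4.2 (b) for all `n`
  (the printed induction); **`lemma54_of`** = Lemma 5.4 from Lemmas 5.1 and 5.3, exactly as in print
  (for `max{√(2n),3} < p ≤ n`: `v_p(d_n⁶ρ_{n,0}) = 6·v_p(d_n) + v_p(ρ_{n,0}) ≥ 6 − 5 = 1`, and `Π_n` is a product
  of distinct primes).
* NAMED FACTS (statement only): `lemma51` (Lemma 5.1), `lemma53` (Lemma 5.3; `p > max{√(2n),3}` rendered as
  `3 < p ∧ 2n < p²`).

Not covered: `R_n(t)`, `S_n`, Lemmas 3.3, 4.1 (the creative-telescoping certificate `T_n(t)`), 4.2 (a) as a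
statement about (def_rho_0)/(def_rho_3), Lemma 5.2's identification (typed as `recurrence` in the companion
file), §§6–7 (Volkenborn integrals, the irrationality measure), (5.2) den-con.
-/

namespace Literature.NumberTheory.Irrationality.LaiSprangZudilin2026

open Finset Literature.Combinatorics.Enumerative.TwoAdicZetaFiveAperyLikeLucas

/-! ## The solutions of (eq:rec) -/

/-- The solution `y` of (eq:rec) `(n+1)⁵y_{n+1} = 32(2n+1)(8n⁴+16n³+20n²+12n+3)y_n − 2¹⁶n⁵y_{n−1}` (`n ≥ 1`) with
initial values `y_0 = y₀`, `y_1 = y₁`. [cite: LaiSprangZudilin2026, §1 (eq:rec), Lemma 4.2 (a)] -/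
def recSol (y₀ y₁ : ℚ) : ℕ → ℚ
  | 0 => y₀
  | 1 => y₁
  | n + 2 =>
      ((recMid (n + 1) : ℚ) * recSol y₀ y₁ (n + 1) - 2 ^ 16 * ((n : ℚ) + 1) ^ 5 * recSol y₀ y₁ n) /
        ((n : ℚ) + 2) ^ 5

/-- `y_0 = y₀`. [cite: LaiSprangZudilin2026, §1 (eq:rec)] -/
@[simp] theorem recSol_zero (y₀ y₁ : ℚ) : recSol y₀ y₁ 0 = y₀ := rfl

/-- `y_1 = y₁`. [cite: LaiSprangZudilin2026, §1 (eq:rec)] -/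
@[simp] theorem recSol_one (y₀ y₁ : ℚ) : recSol y₀ y₁ 1 = y₁ := rfl

/-- The defining step `y_{n+2} = (recMid(n+1)·y_{n+1} − 2¹⁶(n+1)⁵y_n)/(n+2)⁵`. [cite: LaiSprangZudilin2026, §1 (eq:rec)] -/
theorem recSol_succ_succ (y₀ y₁ : ℚ) (n : ℕ) :
    recSol y₀ y₁ (n + 2) =
      ((recMid (n + 1) : ℚ) * recSol y₀ y₁ (n + 1) - 2 ^ 16 * ((n : ℚ) + 1) ^ 5 * recSol y₀ y₁ n) /
        ((n : ℚ) + 2) ^ 5 := rfl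

/-- `recSol y₀ y₁` satisfies (eq:rec): `(n+1)⁵y_{n+1} + 2¹⁶n⁵y_{n−1} = recMid(n)·y_n` for `n ≥ 1`.
[cite: LaiSprangZudilin2026, §1 (eq:rec)] -/
theorem recSol_rec (y₀ y₁ : ℚ) {n : ℕ} (hn : 1 ≤ n) :
    ((n : ℚ) + 1) ^ 5 * recSol y₀ y₁ (n + 1) + 2 ^ 16 * (n : ℚ) ^ 5 * recSol y₀ y₁ (n - 1) =
      (recMid n : ℚ) * recSol y₀ y₁ n := by
  obtain ⟨m, rfl⟩ : ∃ m, n = m + 1 := ⟨n - 1, by omega⟩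
  rw [show m + 1 + 1 = m + 2 from rfl, recSol_succ_succ, Nat.add_sub_cancel]
  have h2 : ((m : ℚ) + 2) ≠ 0 := by positivity
  push_cast
  field_simp
  ring

/-- `ρ_n` as a rational number: the solution of (eq:rec) with `ρ_0 = 1`, `ρ_1 = 96` (equal to the double sum
`lszRho` by Lemma 5.2: `rhoQ_eq_lszRho`). [cite: LaiSprangZudilin2026, Lemma 5.2] -/
def rhoQ : ℕ → ℚ := recSol 1 96

/-- `ρ_{n,0}`: by Lemma 4.2 (a) and the values `ρ_{0,0} = 0`, `ρ_{1,0} = −1024` printed in the proof of Lemma 4.2 (b),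
the solution of (eq:rec) with these initial data (the partial-fraction definition (def_rho_0) is not formalised).
[cite: LaiSprangZudilin2026, Lemma 4.2 (a), proof of Lemma 4.2 (b) (initial values)] -/
def rho0 : ℕ → ℚ := recSol 0 (-1024)

/-- `ρ_{n,3} = 768ρ_n` (Lemma 5.2; `ρ_{0,3} = 768`, `ρ_{1,3} = 73728`). [cite: LaiSprangZudilin2026, Lemma 5.2, proof of Lemma 4.2 (b)] -/
def rho3 (n : ℕ) : ℚ := 768 * rhoQ n

/-- `ρ_2 = 14944` from the recursion (kernel evaluation; agrees with `lszRho_two`). [cite: LaiSprangZudilin2026, §1 (after (eq:rec))] -/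
theorem rhoQ_two : rhoQ 2 = 14944 := by
  norm_num [rhoQ, recSol_succ_succ, recMid]

/-- `ρ_{1,3} = 73728`. [cite: LaiSprangZudilin2026, proof of Lemma 4.2 (b)] -/
theorem rho3_one : rho3 1 = 73728 := by
  norm_num [rho3, rhoQ]

/-- `ρ_{2,0} = −181248` (kernel evaluation of (eq:rec) from the printed initial data).
[cite: LaiSprangZudilin2026, Lemma 4.2 (a) with `ρ_{0,0} = 0`, `ρ_{1,0} = −1024`] -/
theorem rho0_two : rho0 2 = -181248 := by
  norm_num [rho0, recSol_succ_succ, recMid]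

/-- `ρ_{3,0} = −8379400192/243` (kernel evaluation; the first non-integral value, denominator `3⁵`).
[cite: LaiSprangZudilin2026, Lemma 4.2 (a) with `ρ_{0,0} = 0`, `ρ_{1,0} = −1024`] -/
theorem rho0_three : rho0 3 = -8379400192 / 243 := by
  norm_num [rho0, recSol_succ_succ, recMid]

/-- **The bridge to the double sum** (PROVED under the typed Lemma 5.2): if the double sum `lszRho` satisfies
(eq:rec) (`recurrence`), then `ρ_n` computed from the recursion equals it for every `n` (both start `1, 96`).
[cite: LaiSprangZudilin2026, Lemma 5.2] -/
theorem rhoQ_eq_lszRho (h : recurrence) (n : ℕ) : rhoQ n = lszRho n := by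
  suffices H : rhoQ n = lszRho n ∧ rhoQ (n + 1) = lszRho (n + 1) from H.1
  induction n with
  | zero => exact ⟨by simp [rhoQ, lszRho_zero], by simp [rhoQ, lszRho_one]⟩
  | succ m ih =>
    refine ⟨ih.2, ?_⟩
    have hm := h (m + 1) (by omega)
    rw [Nat.add_sub_cancel] at hm
    have hq : ((m : ℚ) + 1 + 1) ^ 5 * (lszRho (m + 1 + 1) : ℚ) + 2 ^ 16 * ((m : ℚ) + 1) ^ 5 * lszRho m =
        (recMid (m + 1) : ℚ) * lszRho (m + 1) := by exact_mod_cast hm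
    rw [show m + 1 + 1 = m + 2 from rfl, rhoQ, recSol_succ_succ, ← rhoQ, ih.1, ih.2]
    have h2 : ((m : ℚ) + 2) ≠ 0 := by positivity
    rw [div_eq_iff (pow_ne_zero 5 h2)]
    rw [show m + 1 + 1 = m + 2 from rfl] at hq
    have e : ((m : ℚ) + 1 + 1) = (m : ℚ) + 2 := by ring
    rw [e] at hq
    linear_combination (-1 : ℚ) * hq

/-! ## Lemma 4.2 (b): the determinant formula -/

/-- The Wronskian step shared by any two solutions of (eq:rec):
`W_{n+1} = 2¹⁶(n+1)⁵/(n+2)⁵ · W_n`, `W_n = x_n y_{n+1} − x_{n+1} y_n`. [cite: LaiSprangZudilin2026, proof of Lemma 4.2 (b)] -/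
theorem wronskian_succ (x₀ x₁ y₀ y₁ : ℚ) (n : ℕ) :
    recSol x₀ x₁ (n + 1) * recSol y₀ y₁ (n + 2) - recSol x₀ x₁ (n + 2) * recSol y₀ y₁ (n + 1) =
      2 ^ 16 * ((n : ℚ) + 1) ^ 5 / ((n : ℚ) + 2) ^ 5 *
        (recSol x₀ x₁ n * recSol y₀ y₁ (n + 1) - recSol x₀ x₁ (n + 1) * recSol y₀ y₁ n) := by
  rw [recSol_succ_succ, recSol_succ_succ]
  have h2 : ((n : ℚ) + 2) ≠ 0 := by positivity
  field_simp
  ring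

/-- **Lemma 4.2 (b)** (PROVED): `ρ_{n,0}ρ_{n+1,3} − ρ_{n+1,0}ρ_{n,3} = 3·2^{16n+18}/(n+1)⁵` for every `n ≥ 0`
(in particular `≠ 0`). [cite: LaiSprangZudilin2026, Lemma 4.2 (b)] -/
theorem determinant_formula (n : ℕ) :
    rho0 n * rho3 (n + 1) - rho0 (n + 1) * rho3 n = 3 * 2 ^ (16 * n + 18) / ((n : ℚ) + 1) ^ 5 := by
  induction n with
  | zero => norm_num [rho0, rho3, rhoQ]
  | succ m ih =>
    have step := wronskian_succ 0 (-1024) 1 96 m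
    simp only [rho0, rho3, rhoQ] at ih ⊢
    have h1 : ((m : ℚ) + 1) ≠ 0 := by positivity
    have h2 : ((m : ℚ) + 2) ≠ 0 := by positivity
    have e : recSol 0 (-1024) (m + 1) * (768 * recSol 1 96 (m + 1 + 1)) -
        recSol 0 (-1024) (m + 1 + 1) * (768 * recSol 1 96 (m + 1)) =
        768 * (recSol 0 (-1024) (m + 1) * recSol 1 96 (m + 2) - recSol 0 (-1024) (m + 2) * recSol 1 96 (m + 1)) := by
      rw [show m + 1 + 1 = m + 2 from rfl]; ring
    rw [e, step]
    have ih' : recSol 0 (-1024) m * recSol 1 96 (m + 1) - recSol 0 (-1024) (m + 1) * recSol 1 96 m =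
        3 * 2 ^ (16 * m + 18) / ((m : ℚ) + 1) ^ 5 / 768 := by
      rw [← ih]; ring
    rw [ih']
    push_cast
    field_simp
    ring

/-- `ρ_{n,0}ρ_{n+1,3} − ρ_{n+1,0}ρ_{n,3} ≠ 0`. [cite: LaiSprangZudilin2026, Lemma 4.2 (b)] -/
theorem determinant_ne_zero (n : ℕ) : rho0 n * rho3 (n + 1) - rho0 (n + 1) * rho3 n ≠ 0 := by
  rw [determinant_formula]
  positivity

/-! ## §5: the arithmetic lemmas -/

/-- **Lemma 5.1** (named fact, statement only): for `n ≥ 1`, `d_n·ρ_{n,3} ∈ ℤ` and `d_n⁶·ρ_{n,0} ∈ ℤ`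
(`d_n = lcm(1,…,n) = Nat.lcmUpto n`). [cite: LaiSprangZudilin2026, Lemma 5.1] -/
def lemma51 : Prop :=
  ∀ n : ℕ, 1 ≤ n →
    (∃ z : ℤ, (Nat.lcmUpto n : ℚ) * rho3 n = z) ∧ (∃ z : ℤ, (Nat.lcmUpto n : ℚ) ^ 6 * rho0 n = z)

/-- **Lemma 5.3** (named fact, statement only): for `n ≥ 1` and any prime `p > max{√(2n), 3}` (i.e. `3 < p` and
`2n < p²`), `v_p(ρ_{n,0}) ≥ −5`. [cite: LaiSprangZudilin2026, Lemma 5.3] -/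
def lemma53 : Prop :=
  ∀ n p : ℕ, 1 ≤ n → p.Prime → 3 < p → 2 * n < p ^ 2 → -5 ≤ padicValRat p (rho0 n)

/-- `Π_n = ∏_{max{√(2n),3} < p ≤ n} p`. [cite: LaiSprangZudilin2026, Lemma 5.4] -/
def primeProd (n : ℕ) : ℕ :=
  ∏ p ∈ (Finset.range (n + 1)).filter (fun p => p.Prime ∧ 3 < p ∧ 2 * n < p ^ 2), p

/-- `Π_n ≠ 0`. [cite: LaiSprangZudilin2026, Lemma 5.4] -/
theorem primeProd_ne_zero (n : ℕ) : primeProd n ≠ 0 := by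
  unfold primeProd
  rw [Finset.prod_ne_zero_iff]
  intro p hp
  rw [Finset.mem_filter] at hp
  exact hp.2.1.ne_zero

/-- **Lemma 5.4** (PROVED from Lemmas 5.1 and 5.3, as in print): for `n ≥ 1`, `Π_n^{−1} d_n⁶·ρ_{n,0} ∈ ℤ`.
[cite: LaiSprangZudilin2026, Lemma 5.4] -/
theorem lemma54_of (h51 : lemma51) (h53 : lemma53) {n : ℕ} (hn : 1 ≤ n) :
    ∃ z : ℤ, (Nat.lcmUpto n : ℚ) ^ 6 / (primeProd n : ℚ) * rho0 n = z := by
  obtain ⟨z, hz⟩ := (h51 n hn).2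
  -- every prime of `Π_n` divides `z = d_n⁶ ρ_{n,0}`
  have hdvd : ∀ p ∈ (Finset.range (n + 1)).filter (fun p => p.Prime ∧ 3 < p ∧ 2 * n < p ^ 2),
      p ∣ z.natAbs := by
    intro p hp
    rw [Finset.mem_filter, Finset.mem_range] at hp
    obtain ⟨hpn, hpr, h3, hsq⟩ := hp
    haveI : Fact p.Prime := ⟨hpr⟩
    by_cases hρ : rho0 n = 0
    · rw [hρ, mul_zero] at hz
      have : z = 0 := by exact_mod_cast hz.symm
      simp [this]
    have hd0 : (Nat.lcmUpto n : ℚ) ≠ 0 := by exact_mod_cast Nat.lcmUpto_ne_zero n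
    have hz0 : z ≠ 0 := by
      intro h0
      rw [h0, Int.cast_zero] at hz
      exact (mul_ne_zero (pow_ne_zero 6 hd0) hρ) hz
    -- valuations
    have hvd : (1 : ℤ) ≤ padicValRat p (Nat.lcmUpto n : ℚ) := by
      rw [padicValRat.of_nat, ← Nat.factorization_def _ hpr, Nat.factorization_lcmUpto n hpr]
      exact_mod_cast Nat.log_pos hpr.one_lt (by omega)
    have hv : (1 : ℤ) ≤ padicValRat p (z : ℚ) := by
      rw [← hz, padicValRat.mul (pow_ne_zero 6 hd0) hρ, padicValRat.pow]
      have := h53 n p hn hpr h3 hsq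
      push_cast
      linarith
    rw [padicValRat.of_int] at hv
    have hdz : (p : ℤ) ∣ z := by
      have := (padicValInt_dvd_iff 1 z).mpr (Or.inr (by exact_mod_cast hv))
      simpa using this
    exact Int.natCast_dvd.mp hdz
  have hprod : primeProd n ∣ z.natAbs :=
    Finset.prod_primes_dvd z.natAbs (fun p hp => ((Finset.mem_filter.mp hp).2.1).prime) hdvd
  obtain ⟨w, hw⟩ := Int.natCast_dvd.mpr hprod
  refine ⟨w, ?_⟩
  have hP : (primeProd n : ℚ) ≠ 0 := by exact_mod_cast primeProd_ne_zero n
  rw [div_mul_eq_mul_div, hz, show (z : ℚ) = ((primeProd n : ℤ) * w : ℤ) by rw [← hw]]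
  push_cast
  field_simp

end Literature.NumberTheory.Irrationality.LaiSprangZudilin2026
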